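import Literature.NumberTheory.Automorphic.ArchLocalTorusOrbitalBlockSmooth           -- ★ (A1) p842196 (F0P3a-p05): `contDiffAt_integral_comp_of_contDiff_of_support`, `contDiffOn_integral_comp_conj_circleDiagonal_angles_of_blocks` (the non-parametric twin)
import Literature.NumberTheory.Rogawski1990.ArchCentralLimitChamberSmooth            -- ★ `angleChart_ne_of_mem_chamber_ball` (chamber points are regular)
import Literature.Geometry.ComplexHyperbolic.UnitBallLieAlgebraHCGenerators           -- ★ `contDiff_rootProduct`
import HarnessLib

/-!
# The torus orbital function WITH A SMOOTH PARAMETER is jointly `C^∞` in (angles, parameter) on the block-separated set — the parametric twin of ★ (A1)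
# (Hörmander I Thm. 1.1.9; Rogawski 1990 §8.2–8.4; Varadarajan 1977 I §3)

Topic `NumberTheory/Automorphic`; namespace `Literature.NumberTheory.Automorphic.UnitaryGroup`.  THEOREMS ONLY (no `def`, no instance, no notation, no axiom, no named fact, no `sorry`).
Cell `pub/hodgecm-mathlib`, crux H413 (`stmt-HodgeConjecture-24833`), F0∕P3c line LH3 (closer stub `stub_N9`, letter L1 clause (I₁)), organ O-L1d «HC-CENTRAL» (B3): the «ONE missing
analytic input `hΨ`» of the (B3-JUNCTION) J1-dress (F0P3a-p05 (g20) 11:07:56Z (a); holder A-p12 (g28)) — the M-leg (P-SMOOTH) of F0P3a-p09 (g7), author of the (B3-ENGINE) ★ p851226, 2026-09-02.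

THE MATHEMATICS.  `G_w = U(σ_w diag α)(ℂ)` (`archLocal L N (diagonal α) w`, any signature), `ν` finite on compacta, `Q` a finite-dimensional real normed parameter space, `Θ : Q × M_N(ℂ) → E`
JOINTLY `C^∞` with `k ↦ Θ(q, ↑↑k)` supported in ONE compact `Cg ⊆ G_w` for all `q`, `b` a constant-sign block labelling of the indices, `ζ ∈ (S¹)^N`.  Then
`(θ, q) ↦ ∫_{G_w} Θ(q, ↑↑(g · diag(ζ_i e^{iθ_i}) · g⁻¹)) dν(g)` is `C^∞` on `{θ block-separated} × Q` — §1 the uniform compact `g`-support on a closed ball of block-separated angles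
(★ (C-cw) `isCompact_setOf_exists_conj_circleDiagonal_mem_of_blocks`, set form), §2 the head (★ `contDiffAt_integral_comp_of_contDiff_of_support` on `V := (Fin N → ℝ) × Q` with
`Ψ((A,B),(θ,q)) := Θ(q, A · diag(ζe^{iθ}) · B)`), §3 the `N = 3` chamber∕`rootProduct` dress = the `hΨ` hypothesis of ★ J1-core `exists_forall_norm_iteratedFDeriv_le_of_smul_integral_family`
(p851213) with `Sθ := C_σ ∩ B(0,½)`, `(θ, q)` order, `Θ (q, X)` — token for token.
HONEST LABEL: HC_CM is proved only modulo the 7 printed citations (2 remaining: hLiu418 = `stmt-HodgeConjecture-24832`, h413 = `stmt-HodgeConjecture-24833`) until rung 0 closes; count-neutral plumbing.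

## References
* [HormanderALPDO1] L. Hörmander, *The Analysis of Linear Partial Differential Operators I*, Grundlehren 256 (1983), §1.1 Thm. 1.1.9 (differentiation under the integral sign).
* [Rogawski1990] J. D. Rogawski, *Automorphic Representations of Unitary Groups in Three Variables*, Ann. of Math. Stud. 123 (1990), §8.2 pp. 122–123, §8.4 p. 126.
* [Varadarajan1977] V. S. Varadarajan, *Harmonic Analysis on Real Reductive Groups*, LNM 576 (1977), Part I §3.
* [DeitmarEchterhoff2014] A. Deitmar, S. Echterhoff, *Principles of Harmonic Analysis*, 2nd ed. (2014), Lemma 9.3.3.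
-/

set_option autoImplicit false

noncomputable section

open MeasureTheory Measure Filter Topology Set Function Metric NumberField NumberField.InfinitePlace
open scoped ContDiff

namespace Literature.NumberTheory.Automorphic.UnitaryGroup

open Literature.Analysis.Calculus Literature.Geometry.ComplexHyperbolic.BallModel
open scoped Matrix MatrixGroups
open scoped Matrix.Norms.Operator

section Blocks

variable (L : Type) [Field L] (N : ℕ) (α : Fin N → L) (w : {w : InfinitePlace L // IsComplex w})
  {E : Type*} [NormedAddCommGroup E] [NormedSpace ℝ E] [CompleteSpace E]

/-! ## §1 Uniform compact `g`-support on a closed ball of block-separated angles (set form) -/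

/-- **UNIFORM PROPERNESS ON A BALL OF BLOCK-SEPARATED ANGLES (set form)**: for a compact `Cg ⊆ G_w` and a block-separated `θ₀` there are `δ > 0` and a compact `S ⊆ G_w` with
`g · diag(ζe^{iθ}) · g⁻¹ ∉ Cg` for all `g ∉ S` and all `θ` in the closed `δ`-ball (★ (C-cw) joint properness over the compact image of the ball, which stays block-separated).
[cite: Rogawski1990, §8.2 pp. 122–123] [cite: DeitmarEchterhoff2014, Lemma 9.3.3] -/
theorem exists_closedBall_isCompact_conj_circleDiagonal_angles_not_mem_of_blocks (hα : ∀ i, α i ≠ 0) (hreal : ∀ i, (w.1.embedding (α i)).im = 0)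
    {ι : Type*} (b : Fin N → ι) (hsign : ∀ i j, i ≠ j → b i = b j → 0 < (w.1.embedding (α i)).re * (w.1.embedding (α j)).re)
    {Cg : Set (archLocal L N (Matrix.diagonal α) w)} (hCg : IsCompact Cg)
    (ζ : Fin N → Circle) (θ₀ : Fin N → ℝ) (hθ₀ : ∀ i j, b i ≠ b j → ζ i * Circle.exp (θ₀ i) ≠ ζ j * Circle.exp (θ₀ j)) :
    ∃ δ : ℝ, 0 < δ ∧ ∃ S : Set (archLocal L N (Matrix.diagonal α) w), IsCompact S ∧ ∀ g ∉ S, ∀ θ ∈ Metric.closedBall θ₀ δ,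
      (g * ⟨circleDiagonal N fun i => ζ i * Circle.exp (θ i), circleDiagonal_mem_archLocal_diagonal L N α w _⟩ * g⁻¹ : archLocal L N (Matrix.diagonal α) w) ∉ Cg := by
  have hzc : Continuous fun θ : Fin N → ℝ => fun i => ζ i * Circle.exp (θ i) :=
    continuous_pi fun i => continuous_const.mul (Circle.exp.continuous.comp (continuous_apply i))
  have hopen : IsOpen {z : Fin N → Circle | ∀ i j, b i ≠ b j → z i ≠ z j} := isOpen_setOf_blockSeparated b
  obtain ⟨δ, hδ, hball⟩ : ∃ δ > 0, Metric.closedBall θ₀ δ ⊆ (fun θ : Fin N → ℝ => fun i => ζ i * Circle.exp (θ i)) ⁻¹' {z : Fin N → Circle | ∀ i j, b i ≠ b j → z i ≠ z j} := by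
    obtain ⟨ε, hε, hεball⟩ := Metric.mem_nhds_iff.1 ((hopen.preimage hzc).mem_nhds (show θ₀ ∈ _ from hθ₀))
    exact ⟨ε / 2, half_pos hε, (Metric.closedBall_subset_ball (half_lt_self hε)).trans hεball⟩
  have hKc : IsCompact ((fun θ : Fin N → ℝ => fun i => ζ i * Circle.exp (θ i)) '' Metric.closedBall θ₀ δ) := (isCompact_closedBall θ₀ δ).image hzc
  have hKsep : (fun θ : Fin N → ℝ => fun i => ζ i * Circle.exp (θ i)) '' Metric.closedBall θ₀ δ ⊆ {z : Fin N → Circle | ∀ i j, b i ≠ b j → z i ≠ z j} := by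
    rintro _ ⟨θ, hθ, rfl⟩; exact hball hθ
  have hS := isCompact_setOf_exists_conj_circleDiagonal_mem_of_blocks L N α w hα hreal b hsign hKc hKsep hCg
  exact ⟨δ, hδ, _, hS, fun g hg θ hθ h => hg ⟨_, ⟨θ, hθ, rfl⟩, h⟩⟩

/-! ## §2 Joint smoothness in (angles, parameter) on the block-separated set -/

variable [MeasurableSpace (archLocal L N (Matrix.diagonal α) w)] [BorelSpace (archLocal L N (Matrix.diagonal α) w)]

/-- **THE PARAMETRIC TORUS ORBITAL FUNCTION IS JOINTLY `C^∞` IN (ANGLES, PARAMETER) ON THE BLOCK-SEPARATED SET** — `G_w = U(σ_w diag α)(ℂ)` of any signature, `ν` finite on compacts,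
`Θ : Q × M_N(ℂ) → E` jointly `C^∞` with `k ↦ Θ(q, ↑↑k)` supported in one compact `Cg ⊆ G_w` for every `q`, `b` a constant-sign labelling:
`(θ, q) ↦ ∫_{G_w} Θ(q, ↑↑(g·diag(ζ_i e^{iθ_i})·g⁻¹)) dν` is `ContDiffOn ℝ ∞` on `{θ | b_i ≠ b_j ⇒ ζ_i e^{iθ_i} ≠ ζ_j e^{iθ_j}} ×ˢ univ` (★ `contDiffAt_integral_comp_of_contDiff_of_support` on the
finite-dimensional `V := (Fin N → ℝ) × Q` with `Ψ((A,B),(θ,q)) := Θ(q, A·diag(ζe^{iθ})·B)`, `y(g) = (↑g, ↑g⁻¹)`, uniform support §1).  The parametric twin of ★ (A1)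
`contDiffOn_integral_comp_conj_circleDiagonal_angles_of_blocks`. [cite: HormanderALPDO1, §1.1 Thm. 1.1.9] [cite: Rogawski1990, §8.2 pp. 122–123; §8.4 p. 126] [cite: Varadarajan1977, I §3] -/
theorem contDiffOn_integral_comp_conj_circleDiagonal_angles_param_of_blocks (hα : ∀ i, α i ≠ 0) (hreal : ∀ i, (w.1.embedding (α i)).im = 0)
    {ι : Type*} (b : Fin N → ι) (hsign : ∀ i j, i ≠ j → b i = b j → 0 < (w.1.embedding (α i)).re * (w.1.embedding (α j)).re)
    (ν : Measure (archLocal L N (Matrix.diagonal α) w)) [IsFiniteMeasureOnCompacts ν]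
    {Q : Type*} [NormedAddCommGroup Q] [NormedSpace ℝ Q] [FiniteDimensional ℝ Q]
    (Θ : Q × Matrix (Fin N) (Fin N) ℂ → E) (hΘ : ContDiff ℝ ∞ Θ)
    {Cg : Set (archLocal L N (Matrix.diagonal α) w)} (hCg : IsCompact Cg)
    (h0 : ∀ q : Q, ∀ k : archLocal L N (Matrix.diagonal α) w, k ∉ Cg → Θ (q, ((k : GL (Fin N) ℂ) : Matrix (Fin N) (Fin N) ℂ)) = 0)
    (ζ : Fin N → Circle) :
    ContDiffOn ℝ ∞ (fun z : (Fin N → ℝ) × Q => ∫ g : archLocal L N (Matrix.diagonal α) w,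
        Θ (z.2, (((g * ⟨circleDiagonal N fun i => ζ i * Circle.exp (z.1 i), circleDiagonal_mem_archLocal_diagonal L N α w _⟩ * g⁻¹ :
          archLocal L N (Matrix.diagonal α) w) : GL (Fin N) ℂ) : Matrix (Fin N) (Fin N) ℂ)) ∂ν)
      ({θ : Fin N → ℝ | ∀ i j, b i ≠ b j → ζ i * Circle.exp (θ i) ≠ ζ j * Circle.exp (θ j)} ×ˢ univ) := by
  rintro ⟨θ₀, q₀⟩ ⟨hθ₀, -⟩
  refine ContDiffAt.contDiffWithinAt ?_
  -- the jointly smooth integrand on `(M × M) × ((Fin N → ℝ) × Q)` and the continuous parameter map `y(g) = (↑g, ↑g⁻¹)`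
  set Ψ : (Matrix (Fin N) (Fin N) ℂ × Matrix (Fin N) (Fin N) ℂ) × ((Fin N → ℝ) × Q) → E :=
    fun p => Θ (p.2.2, p.1.1 * ((circleDiagonal N fun i => ζ i * Circle.exp (p.2.1 i) : GL (Fin N) ℂ) : Matrix (Fin N) (Fin N) ℂ) * p.1.2) with hΨ
  have hΨd : ContDiff ℝ ∞ Ψ :=
    hΘ.comp ((contDiff_snd.comp contDiff_snd).prodMk
      (((contDiff_fst.comp contDiff_fst).mul ((contDiff_coe_circleDiagonal_angles N ζ).comp (contDiff_fst.comp contDiff_snd))).mul (contDiff_snd.comp contDiff_fst)))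
  set y : archLocal L N (Matrix.diagonal α) w → Matrix (Fin N) (Fin N) ℂ × Matrix (Fin N) (Fin N) ℂ :=
    fun g => (((g : GL (Fin N) ℂ) : Matrix (Fin N) (Fin N) ℂ), (((g⁻¹ : archLocal L N (Matrix.diagonal α) w) : GL (Fin N) ℂ) : Matrix (Fin N) (Fin N) ℂ)) with hy
  have hyc : Continuous y :=
    (Units.continuous_val.comp continuous_subtype_val).prodMk ((Units.continuous_val.comp continuous_subtype_val).comp continuous_inv)
  have hΨy : ∀ (g : archLocal L N (Matrix.diagonal α) w) (z : (Fin N → ℝ) × Q), Ψ (y g, z) =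
      Θ (z.2, (((g * ⟨circleDiagonal N fun i => ζ i * Circle.exp (z.1 i), circleDiagonal_mem_archLocal_diagonal L N α w _⟩ * g⁻¹ :
        archLocal L N (Matrix.diagonal α) w) : GL (Fin N) ℂ) : Matrix (Fin N) (Fin N) ℂ)) := fun g z => by
    simp only [hΨ, hy, coe_conj_archLocal]
  -- the uniform compact support near `(θ₀, q₀)`: the ball in `θ` times all of `Q`
  obtain ⟨δ, hδ, S, hS, hS0⟩ := exists_closedBall_isCompact_conj_circleDiagonal_angles_not_mem_of_blocks L N α w hα hreal b hsign hCg ζ θ₀ hθ₀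
  have hU : (Metric.closedBall θ₀ δ ×ˢ (univ : Set Q)) ∈ 𝓝 ((θ₀, q₀) : (Fin N → ℝ) × Q) :=
    prod_mem_nhds (Metric.closedBall_mem_nhds θ₀ hδ) univ_mem
  have key := contDiffAt_integral_comp_of_contDiff_of_support ν Ψ hΨd y hyc ((θ₀, q₀) : (Fin N → ℝ) × Q) hS hU
    (fun g hg z hz => by
      rw [hΨy]
      exact h0 z.2 _ (hS0 g hg z.1 hz.1))
  have hfun : (fun z : (Fin N → ℝ) × Q => ∫ g : archLocal L N (Matrix.diagonal α) w,
      Θ (z.2, (((g * ⟨circleDiagonal N fun i => ζ i * Circle.exp (z.1 i), circleDiagonal_mem_archLocal_diagonal L N α w _⟩ * g⁻¹ :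
        archLocal L N (Matrix.diagonal α) w) : GL (Fin N) ℂ) : Matrix (Fin N) (Fin N) ℂ)) ∂ν) = fun z => ∫ t, Ψ (y t, z) ∂ν := by
    funext z
    exact integral_congr_ae (Eventually.of_forall fun g => (hΨy g z).symm)
  rw [hfun]
  exact key

end Blocks

/-! ## §3 `N = 3`: the chamber ∕ `rootProduct` dress — the `hΨ` hypothesis of ★ J1-core -/

section Chamber

variable (L : Type) [Field L] (α : Fin 3 → L) (w : {w : InfinitePlace L // IsComplex w})
  {E : Type*} [NormedAddCommGroup E] [NormedSpace ℝ E] [CompleteSpace E]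
  [MeasurableSpace (archLocal L 3 (Matrix.diagonal α) w)] [BorelSpace (archLocal L 3 (Matrix.diagonal α) w)]

/-- **ON A CHAMBER PIECE `C_σ ∩ B(0,½)` (one centre `ζ`), EVERY FRAME**: `(θ, q) ↦ ∫_{G_w} Θ(q, ↑↑(g·diag(ζe^{iθ_k})·g⁻¹)) dν` is jointly `C^∞` on `(C_σ ∩ B(0,½)) ×ˢ univ`
(§2 with singleton blocks — the chart point is regular there, ★ `angleChart_ne_of_mem_chamber_ball`). [cite: HormanderALPDO1, §1.1 Thm. 1.1.9] [cite: Rogawski1990, §8.4 p. 126] -/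
theorem contDiffOn_integral_comp_conj_circleDiagonal_param_chamber_ball (hα : ∀ i, α i ≠ 0) (hreal : ∀ i, (w.1.embedding (α i)).im = 0)
    (ν : Measure (archLocal L 3 (Matrix.diagonal α) w)) [IsFiniteMeasureOnCompacts ν]
    {Q : Type*} [NormedAddCommGroup Q] [NormedSpace ℝ Q] [FiniteDimensional ℝ Q]
    (Θ : Q × Matrix (Fin 3) (Fin 3) ℂ → E) (hΘ : ContDiff ℝ ∞ Θ)
    {Cg : Set (archLocal L 3 (Matrix.diagonal α) w)} (hCg : IsCompact Cg)
    (h0 : ∀ q : Q, ∀ k : archLocal L 3 (Matrix.diagonal α) w, k ∉ Cg → Θ (q, ((k : GL (Fin 3) ℂ) : Matrix (Fin 3) (Fin 3) ℂ)) = 0)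
    (ζ : Circle) (σ : Equiv.Perm (Fin 3)) :
    ContDiffOn ℝ ∞ (fun z : (Fin 3 → ℝ) × Q => ∫ g : archLocal L 3 (Matrix.diagonal α) w,
        Θ (z.2, (((g * ⟨circleDiagonal 3 fun k => ζ * Circle.exp (z.1 k), circleDiagonal_mem_archLocal_diagonal L 3 α w _⟩ * g⁻¹ :
          archLocal L 3 (Matrix.diagonal α) w) : GL (Fin 3) ℂ) : Matrix (Fin 3) (Fin 3) ℂ)) ∂ν)
      (({θ : Fin 3 → ℝ | θ (σ 0) < θ (σ 1) ∧ θ (σ 1) < θ (σ 2)} ∩ ball (0 : Fin 3 → ℝ) (1 / 2)) ×ˢ univ) := by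
  have h := contDiffOn_integral_comp_conj_circleDiagonal_angles_param_of_blocks L 3 α w hα hreal (b := fun i : Fin 3 => i)
    (fun i j hij hb => absurd hb hij) ν Θ hΘ hCg h0 (fun _ : Fin 3 => ζ)
  refine h.mono (prod_mono (fun θ hθ i j hij => ?_) le_rfl)
  exact Literature.NumberTheory.Rogawski1990.angleChart_ne_of_mem_chamber_ball ζ σ hθ i j hij

/-- **THE `hΨ` HYPOTHESIS OF ★ J1-core, EVERY FRAME**: `(θ, q) ↦ π(θ) • ∫_{G_w} Θ(q, ↑↑(g·diag(ζe^{iθ_k})·g⁻¹)) dν` is jointly `C^∞` on `(C_σ ∩ B(0,½)) ×ˢ univ` — token for token the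
`hΨ : ContDiffOn ℝ ∞ Ψ (Sθ ×ˢ O)` ∕ `hrep : Ψ z = r z.1 • ∫ y, Θ (z.2, κ y z.1) ∂μ` of ★ `Literature.Analysis.Calculus.exists_forall_norm_iteratedFDeriv_le_of_smul_integral_family` (p851213) with
`r := rootProduct`, `κ g θ := ↑↑(g · diag(ζe^{iθ}) · g⁻¹)`, `Sθ := C_σ ∩ B(0,½)`, any open `O` by `.mono`. [cite: HormanderALPDO1, §1.1 Thm. 1.1.9] [cite: Rogawski1990, §8.4 p. 126] [cite: Varadarajan1977, I §3] -/
theorem contDiffOn_rootProduct_smul_integral_param_chamber_ball (hα : ∀ i, α i ≠ 0) (hreal : ∀ i, (w.1.embedding (α i)).im = 0)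
    (ν : Measure (archLocal L 3 (Matrix.diagonal α) w)) [IsFiniteMeasureOnCompacts ν]
    {Q : Type*} [NormedAddCommGroup Q] [NormedSpace ℝ Q] [FiniteDimensional ℝ Q]
    (Θ : Q × Matrix (Fin 3) (Fin 3) ℂ → E) (hΘ : ContDiff ℝ ∞ Θ)
    {Cg : Set (archLocal L 3 (Matrix.diagonal α) w)} (hCg : IsCompact Cg)
    (h0 : ∀ q : Q, ∀ k : archLocal L 3 (Matrix.diagonal α) w, k ∉ Cg → Θ (q, ((k : GL (Fin 3) ℂ) : Matrix (Fin 3) (Fin 3) ℂ)) = 0)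
    (ζ : Circle) (σ : Equiv.Perm (Fin 3)) :
    ContDiffOn ℝ ∞ (fun z : (Fin 3 → ℝ) × Q => (rootProduct z.1 : ℝ) • ∫ g : archLocal L 3 (Matrix.diagonal α) w,
        Θ (z.2, (((g * ⟨circleDiagonal 3 fun k => ζ * Circle.exp (z.1 k), circleDiagonal_mem_archLocal_diagonal L 3 α w _⟩ * g⁻¹ :
          archLocal L 3 (Matrix.diagonal α) w) : GL (Fin 3) ℂ) : Matrix (Fin 3) (Fin 3) ℂ)) ∂ν)
      (({θ : Fin 3 → ℝ | θ (σ 0) < θ (σ 1) ∧ θ (σ 1) < θ (σ 2)} ∩ ball (0 : Fin 3 → ℝ) (1 / 2)) ×ˢ univ) :=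
  (contDiff_rootProduct.comp contDiff_fst).contDiffOn.smul
    (contDiffOn_integral_comp_conj_circleDiagonal_param_chamber_ball L α w hα hreal ν Θ hΘ hCg h0 ζ σ)

/-- **PARAMETER-FIRST ORDER** (the `h1 : ContDiffOn ℝ ∞ (fun z : P × V => Φ (g z.1) z.2) (Q ×ˢ T)` socket of ★ (E1) `exists_forall_norm_iteratedFDeriv_blockReader_le_of_uniform_on`, p851230,
central instance `V := Fin 3 → ℝ`, `T := C_σ ∩ B(0,½)`): `(q, θ) ↦ π(θ) • ∫_{G_w} Θ(q, ↑↑(g·diag(ζe^{iθ_k})·g⁻¹)) dν` is jointly `C^∞` on `univ ×ˢ (C_σ ∩ B(0,½))` (the previous theorem through the swap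
`(q, θ) ↦ (θ, q)`; restrict to any open `Q ⊆ univ` by `.mono`). [cite: HormanderALPDO1, §1.1 Thm. 1.1.9] [cite: Rogawski1990, §8.4 p. 126] -/
theorem contDiffOn_rootProduct_smul_integral_param_chamber_ball_swap (hα : ∀ i, α i ≠ 0) (hreal : ∀ i, (w.1.embedding (α i)).im = 0)
    (ν : Measure (archLocal L 3 (Matrix.diagonal α) w)) [IsFiniteMeasureOnCompacts ν]
    {Q : Type*} [NormedAddCommGroup Q] [NormedSpace ℝ Q] [FiniteDimensional ℝ Q]
    (Θ : Q × Matrix (Fin 3) (Fin 3) ℂ → E) (hΘ : ContDiff ℝ ∞ Θ)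
    {Cg : Set (archLocal L 3 (Matrix.diagonal α) w)} (hCg : IsCompact Cg)
    (h0 : ∀ q : Q, ∀ k : archLocal L 3 (Matrix.diagonal α) w, k ∉ Cg → Θ (q, ((k : GL (Fin 3) ℂ) : Matrix (Fin 3) (Fin 3) ℂ)) = 0)
    (ζ : Circle) (σ : Equiv.Perm (Fin 3)) :
    ContDiffOn ℝ ∞ (fun z : Q × (Fin 3 → ℝ) => (rootProduct z.2 : ℝ) • ∫ g : archLocal L 3 (Matrix.diagonal α) w,
        Θ (z.1, (((g * ⟨circleDiagonal 3 fun k => ζ * Circle.exp (z.2 k), circleDiagonal_mem_archLocal_diagonal L 3 α w _⟩ * g⁻¹ :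
          archLocal L 3 (Matrix.diagonal α) w) : GL (Fin 3) ℂ) : Matrix (Fin 3) (Fin 3) ℂ)) ∂ν)
      (univ ×ˢ ({θ : Fin 3 → ℝ | θ (σ 0) < θ (σ 1) ∧ θ (σ 1) < θ (σ 2)} ∩ ball (0 : Fin 3 → ℝ) (1 / 2))) := by
  have h := contDiffOn_rootProduct_smul_integral_param_chamber_ball L α w hα hreal ν Θ hΘ hCg h0 ζ σ
  have hswap : ContDiff ℝ ∞ (fun z : Q × (Fin 3 → ℝ) => ((z.2, z.1) : (Fin 3 → ℝ) × Q)) := contDiff_snd.prodMk contDiff_fst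
  refine (h.comp hswap.contDiffOn ?_).congr (fun z _ => rfl)
  rintro ⟨q, θ⟩ ⟨-, hθ⟩
  exact ⟨hθ, mem_univ _⟩

end Chamber

end Literature.NumberTheory.Automorphic.UnitaryGroup

end
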